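import Summits.ValiantsHypothesis.ValiantsHypothesis.Theorems.NewtonFramesTwoProductsFrameRungTwoCoverThree

/-!
# Crux `TwoProducts` (stmt-5906), line `FrameRungTwo`: the `k = 2` cross-cancelling count from ANY bounded-gap covering
# (the `K`-gap family; re-targeting the shallow-neighbour hypothesis `hIX`)

`…FrameRungTwoShallowNeighbour.lean` (p603280) reduced the `k = 2` count for two arbitrary dissociated frames to the per-vertex
dichotomy (IX) = `hIX`: member depth `≤ 3` OR a shallow non-member neighbour — both disjuncts put the vertex into the THREE-gap
family of `…FrameRungTwoCoverThree.lean`.  The general case of (IX) is open (memos `Cruxes/TwoProducts/memo-IX-blocks.md`,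
`memo-IX-windows.md`); the second memo shows that (IX) is SHARP at member depth 3 and records the numerically exact, more robust law
"T4": at every cross-cancelling vertex of member depth `≥ 2` the top gap `d = T − e` is a sum of AT MOST FOUR letter gaps of the other
frame (repetitions allowed) — true in all ≈ 2·10⁵ sampled factorization pairs INCLUDING member depth 2 and 3, where (IX) fails.
For the COUNT any fixed number `K` of gaps is as good as three.  This file provides the `K`-gap version of the reduction, so that ANY
per-vertex statement "e is within `K` letter gaps of the key-top tuple of `f` or of `g`" yields `#cross-cancelling vertices ≤
2 (4(mt)² + 7)(mt + 1)^K`: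

* `card_coverK_le`   — the `K`-gap family of a frame with `≤ t` letters per coordinate has `≤ (4(mt)²+7)(mt+1)^K` points;
* `mem_coverK`        — raw membership (a key-top tuple and `K` optional (coordinate, letter) pairs);
* `crossCancel_of_gapCover` — the count from the per-vertex `K`-gap hypotheses `hcov` / `hcov'` (words of `f` / of `g`).

(IX) is the case `K = 3`; T4 is the case `K = 4` with the first disjunct "member depth ≤ 1".  Honest scope: a CONDITIONAL count for ONE
stub of a rung strictly below the crux `TwoProducts`; nothing here bears on `VP ≠ VNP`. [ours; setting KPTT arXiv:1308.2286 §2, §5]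
-/

set_option linter.dupNamespace false

namespace Summit.ValiantsHypothesis.ValiantsHypothesis.Theorems.NewtonFramesTwoProducts.FrameRungTwoTrinomial

open MvPolynomial
open scoped BigOperators Classical
open Summit.ValiantsHypothesis.Theorems.DissociatedFixedK (lexKey lexKey_injective lexTop lexTop_mem lexKey_le_lexTop
  stub_topTupleCount)
open Summit.ValiantsHypothesis.ValiantsHypothesis.Theorems.DissociatedFixedK.Negative (emb emb_injective)
open Summit.ValiantsHypothesis.ValiantsHypothesis.Theorems.NewtonFramesTwoProducts.FrameRungTwoBinomial
  (emb_add emb_sum top_eq exists_word cross_empty_of_union_subset)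

noncomputable section

section CoverK

variable {m : ℕ}

/-- **Size of the `K`-gap family.** [ours] -/
theorem card_coverK_le (K t : ℕ) (f : Fin m → MvPolynomial (Fin 2) ℂ) (hS : ∀ j, ((f j).support).card ≤ t) :
    (((Fintype.piFinset fun j => (f j).support).filter fun b =>
        ∃ l : (Fin 2 → ℝ) →L[ℝ] ℝ, ∀ j, ∀ x ∈ (f j).support, lexKey l x ≤ lexKey l (b j)).biUnion fun b =>
      (Fintype.piFinset fun _ : Fin K =>
          Finset.insertNone (Finset.univ.biUnion fun j => ((f j).support).image (Prod.mk j))).image fun q =>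
        emb (∑ j, b j) - ∑ i, Option.elim (q i) (0 : Fin 2 → ℝ) (fun p => emb (b p.1) - emb p.2)).card
      ≤ (4 * (m * t) ^ 2 + 7) * (m * t + 1) ^ K := by
  have hBT : ((Fintype.piFinset fun j => (f j).support).filter fun b =>
      ∃ l : (Fin 2 → ℝ) →L[ℝ] ℝ, ∀ j, ∀ x ∈ (f j).support, lexKey l x ≤ lexKey l (b j)).card
      ≤ 4 * (m * t) ^ 2 + 7 :=
    stub_topTupleCount m t (fun j => (f j).support) hS
  have hLET : (Finset.univ.biUnion fun j => ((f j).support).image (Prod.mk j)).card ≤ m * t := by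
    calc (Finset.univ.biUnion fun j => ((f j).support).image (Prod.mk j)).card
        ≤ ∑ j, (((f j).support).image (Prod.mk j)).card := Finset.card_biUnion_le
      _ ≤ ∑ _j : Fin m, t := Finset.sum_le_sum fun j _ => Finset.card_image_le.trans (hS j)
      _ = m * t := by simp
  have hS' : (Finset.insertNone (Finset.univ.biUnion fun j => ((f j).support).image (Prod.mk j))).card ≤ m * t + 1 := by
    rw [Finset.card_insertNone]; exact Nat.add_le_add_right hLET 1
  have hQ : (Fintype.piFinset fun _ : Fin K =>
      Finset.insertNone (Finset.univ.biUnion fun j => ((f j).support).image (Prod.mk j))).card ≤ (m * t + 1) ^ K := by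
    rw [Fintype.card_piFinset, Finset.prod_const, Finset.card_univ, Fintype.card_fin]
    exact Nat.pow_le_pow_left hS' K
  calc _ ≤ ∑ b ∈ ((Fintype.piFinset fun j => (f j).support).filter fun b =>
          ∃ l : (Fin 2 → ℝ) →L[ℝ] ℝ, ∀ j, ∀ x ∈ (f j).support, lexKey l x ≤ lexKey l (b j)),
          ((Fintype.piFinset fun _ : Fin K =>
              Finset.insertNone (Finset.univ.biUnion fun j => ((f j).support).image (Prod.mk j))).image fun q =>
            emb (∑ j, b j) - ∑ i, Option.elim (q i) (0 : Fin 2 → ℝ) (fun p => emb (b p.1) - emb p.2)).card :=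
        Finset.card_biUnion_le
    _ ≤ ∑ _b ∈ ((Fintype.piFinset fun j => (f j).support).filter fun b =>
          ∃ l : (Fin 2 → ℝ) →L[ℝ] ℝ, ∀ j, ∀ x ∈ (f j).support, lexKey l x ≤ lexKey l (b j)), (m * t + 1) ^ K :=
        Finset.sum_le_sum fun b _ => Finset.card_image_le.trans hQ
    _ = ((Fintype.piFinset fun j => (f j).support).filter fun b =>
          ∃ l : (Fin 2 → ℝ) →L[ℝ] ℝ, ∀ j, ∀ x ∈ (f j).support, lexKey l x ≤ lexKey l (b j)).card * (m * t + 1) ^ K := by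
        rw [Finset.sum_const, smul_eq_mul]
    _ ≤ (4 * (m * t) ^ 2 + 7) * (m * t + 1) ^ K := Nat.mul_le_mul_right _ hBT

/-- **Membership, raw form.**  For a key-top tuple `T` (for some functional) and `K` optional (coordinate, letter) pairs. [ours] -/
theorem mem_coverK {K : ℕ} (l : (Fin 2 → ℝ) →L[ℝ] ℝ) (f : Fin m → MvPolynomial (Fin 2) ℂ) (T : Fin m → (Fin 2 →₀ ℕ))
    (hT : ∀ j, T j ∈ (f j).support) (hTmax : ∀ j, ∀ x ∈ (f j).support, lexKey l x ≤ lexKey l (T j))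
    (q : Fin K → Option (Fin m × (Fin 2 →₀ ℕ))) (hq : ∀ i p, q i = some p → p.2 ∈ (f p.1).support) :
    emb (∑ j, T j) - ∑ i, Option.elim (q i) (0 : Fin 2 → ℝ) (fun p => emb (T p.1) - emb p.2) ∈
      ((Fintype.piFinset fun j => (f j).support).filter fun b =>
        ∃ l : (Fin 2 → ℝ) →L[ℝ] ℝ, ∀ j, ∀ x ∈ (f j).support, lexKey l x ≤ lexKey l (b j)).biUnion fun b =>
      (Fintype.piFinset fun _ : Fin K =>
          Finset.insertNone (Finset.univ.biUnion fun j => ((f j).support).image (Prod.mk j))).image fun q =>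
        emb (∑ j, b j) - ∑ i, Option.elim (q i) (0 : Fin 2 → ℝ) (fun p => emb (b p.1) - emb p.2) := by
  have hb : T ∈ (Fintype.piFinset fun j => (f j).support).filter fun b =>
      ∃ l : (Fin 2 → ℝ) →L[ℝ] ℝ, ∀ j, ∀ x ∈ (f j).support, lexKey l x ≤ lexKey l (b j) :=
    Finset.mem_filter.2 ⟨Fintype.mem_piFinset.2 hT, l, hTmax⟩
  have hmemS : ∀ o : Option (Fin m × (Fin 2 →₀ ℕ)), (∀ p, o = some p → p.2 ∈ (f p.1).support) →
      o ∈ Finset.insertNone (Finset.univ.biUnion fun j => ((f j).support).image (Prod.mk j)) := by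
    intro o ho
    cases o with
    | none => exact Finset.none_mem_insertNone
    | some p =>
      rw [Finset.some_mem_insertNone]
      exact Finset.mem_biUnion.2 ⟨p.1, Finset.mem_univ _, Finset.mem_image.2 ⟨p.2, ho p rfl, rfl⟩⟩
  refine Finset.mem_biUnion.2 ⟨T, hb, Finset.mem_image.2 ⟨q, ?_, rfl⟩⟩
  exact Fintype.mem_piFinset.2 fun i => hmemS (q i) (hq i)

/-- A word demoting at most `K` letters of its key-top tuple is the top sum minus `K` optional letter gaps. [ours] -/
theorem exists_gapForm_of_card_le (K : ℕ) (f : Fin m → MvPolynomial (Fin 2) ℂ) (T a : Fin m → (Fin 2 →₀ ℕ))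
    (ha : ∀ j, a j ∈ (f j).support) (hcard : (Finset.univ.filter fun i => a i ≠ T i).card ≤ K) :
    ∃ q : Fin K → Option (Fin m × (Fin 2 →₀ ℕ)), (∀ i p, q i = some p → p.2 ∈ (f p.1).support) ∧
      emb (∑ j, a j) = emb (∑ j, T j) - ∑ i, Option.elim (q i) (0 : Fin 2 → ℝ) (fun p => emb (T p.1) - emb p.2) := by
  set D := Finset.univ.filter fun i => a i ≠ T i with hD
  set n := D.card with hn
  set σ := D.equivFin with hσ
  -- the `ℕ`-indexed list of gaps of `a`, padded with zeros
  set F : ℕ → (Fin 2 → ℝ) := fun i => if h : i < n then emb (T (σ.symm ⟨i, h⟩).1) - emb (a (σ.symm ⟨i, h⟩).1) else 0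
    with hF
  refine ⟨fun i => if h : (i : ℕ) < n then some ((σ.symm ⟨i, h⟩).1, a (σ.symm ⟨i, h⟩).1) else none, ?_, ?_⟩
  · intro i p hp
    by_cases h : (i : ℕ) < n
    · simp only [dif_pos h] at hp
      cases hp
      exact ha _
    · simp only [dif_neg h] at hp
      cases hp
  · have hsum : ∑ i : Fin K, Option.elim
        (if h : (i : ℕ) < n then some ((σ.symm ⟨i, h⟩).1, a (σ.symm ⟨i, h⟩).1) else none)
        (0 : Fin 2 → ℝ) (fun p => emb (T p.1) - emb p.2) = ∑ i : Fin K, F i := by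
      refine Finset.sum_congr rfl fun i _ => ?_
      by_cases h : (i : ℕ) < n
      · simp only [dif_pos h, hF, Option.elim]
      · simp only [dif_neg h, hF, Option.elim]
    rw [hsum, Fin.sum_univ_eq_sum_range F K]
    have hvan : ∀ i ∈ Finset.range K, i ∉ Finset.range n → F i = 0 := by
      intro i _ hi
      rw [Finset.mem_range, not_lt] at hi
      simp only [hF, dif_neg (not_lt.2 hi)]
    rw [← Finset.sum_subset (Finset.range_subset_range.2 hcard) hvan, ← Fin.sum_univ_eq_sum_range F n]
    have hF' : ∀ i : Fin n, F i = emb (T (σ.symm i).1) - emb (a (σ.symm i).1) := by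
      intro i
      obtain ⟨iv, ih⟩ := i
      simp only [hF, dif_pos ih]
    simp only [hF']
    rw [emb_sum_eq T a, sum_gap_eq_sum_filter T a]
    congr 1
    rw [← Finset.sum_coe_sort D]
    exact (Equiv.sum_comp σ.symm (fun x : D => emb (T x.1) - emb (a x.1))).symm

/-- **Words demoting at most `K` letters lie in the `K`-gap family** (w.r.t. their key-top tuple). [ours] -/
theorem mem_coverK_of_card_le (K : ℕ) (l : (Fin 2 → ℝ) →L[ℝ] ℝ) (f : Fin m → MvPolynomial (Fin 2) ℂ)
    (T : Fin m → (Fin 2 →₀ ℕ)) (hT : ∀ j, T j ∈ (f j).support)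
    (hTmax : ∀ j, ∀ x ∈ (f j).support, lexKey l x ≤ lexKey l (T j))
    (a : Fin m → (Fin 2 →₀ ℕ)) (ha : ∀ j, a j ∈ (f j).support)
    (hcard : (Finset.univ.filter fun i => a i ≠ T i).card ≤ K) :
    emb (∑ j, a j) ∈
      ((Fintype.piFinset fun j => (f j).support).filter fun b =>
        ∃ l : (Fin 2 → ℝ) →L[ℝ] ℝ, ∀ j, ∀ x ∈ (f j).support, lexKey l x ≤ lexKey l (b j)).biUnion fun b =>
      (Fintype.piFinset fun _ : Fin K =>
          Finset.insertNone (Finset.univ.biUnion fun j => ((f j).support).image (Prod.mk j))).image fun q =>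
        emb (∑ j, b j) - ∑ i, Option.elim (q i) (0 : Fin 2 → ℝ) (fun p => emb (b p.1) - emb p.2) := by
  obtain ⟨q, hq, hE⟩ := exists_gapForm_of_card_le K f T a ha hcard
  rw [hE]
  exact mem_coverK l f T hT hTmax q hq

/-- **The `k = 2` cross-cancelling count from a `K`-gap covering** (two dissociated frames, one product each, any `t`, carries allowed).
`hcov` / `hcov'`: every cross-cancelling vertex whose word lives in `f` / in `g` is, in exponent space, the key-top sum of `f` or of
`g` minus at most `K` letter gaps of that frame (coordinates and letters arbitrary, repetitions allowed).  (IX) of p603280 gives this with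
`K = 3`; the conjectural law T4 of `memo-IX-windows.md` gives it with `K = 4`. [ours] -/
theorem crossCancel_of_gapCover (K m t : ℕ) (A B : Fin m → Finset (Fin 2 →₀ ℕ))
    (f g : Fin m → MvPolynomial (Fin 2) ℂ)
    (hA : ∀ j, (A j).card ≤ t) (hB : ∀ j, (B j).card ≤ t)
    (hf : ∀ j, (f j).support ⊆ A j) (hg : ∀ j, (g j).support ⊆ B j)
    (hinjA : ∀ a b : Fin m → (Fin 2 →₀ ℕ), (∀ j, a j ∈ A j) → (∀ j, b j ∈ A j) → ∑ j, a j = ∑ j, b j → a = b)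
    (hinjB : ∀ a b : Fin m → (Fin 2 →₀ ℕ), (∀ j, a j ∈ B j) → (∀ j, b j ∈ B j) → ∑ j, a j = ∑ j, b j → a = b)
    (hcov : ∀ (lc : (Fin 2 → ℝ) →L[ℝ] ℝ) (e : Fin 2 →₀ ℕ) (T T' a : Fin m → (Fin 2 →₀ ℕ)),
      (∀ j, T j ∈ (f j).support) → (∀ j, ∀ x ∈ (f j).support, lexKey lc x ≤ lexKey lc (T j)) →
      (∀ j, T' j ∈ (g j).support) → (∀ j, ∀ x ∈ (g j).support, lexKey lc x ≤ lexKey lc (T' j)) →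
      (∀ j, a j ∈ (f j).support) → ∑ j, a j = e →
      (∀ x : Fin 2 →₀ ℕ, x ≠ e → lc (emb e) ≤ lc (emb x) → coeff x (∏ j, f j) + coeff x (∏ j, g j) = 0) →
      coeff e (∏ j, f j) + coeff e (∏ j, g j) ≠ 0 → ∑ j, T j = ∑ j, T' j → lexKey lc e < lexKey lc (∑ j, T j) →
      (∃ q : Fin K → Option (Fin m × (Fin 2 →₀ ℕ)), (∀ i p, q i = some p → p.2 ∈ (f p.1).support) ∧
          emb e = emb (∑ j, T j) - ∑ i, Option.elim (q i) (0 : Fin 2 → ℝ) (fun p => emb (T p.1) - emb p.2)) ∨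
        ∃ q : Fin K → Option (Fin m × (Fin 2 →₀ ℕ)), (∀ i p, q i = some p → p.2 ∈ (g p.1).support) ∧
          emb e = emb (∑ j, T' j) - ∑ i, Option.elim (q i) (0 : Fin 2 → ℝ) (fun p => emb (T' p.1) - emb p.2))
    (hcov' : ∀ (lc : (Fin 2 → ℝ) →L[ℝ] ℝ) (e : Fin 2 →₀ ℕ) (T' T a : Fin m → (Fin 2 →₀ ℕ)),
      (∀ j, T' j ∈ (g j).support) → (∀ j, ∀ x ∈ (g j).support, lexKey lc x ≤ lexKey lc (T' j)) →
      (∀ j, T j ∈ (f j).support) → (∀ j, ∀ x ∈ (f j).support, lexKey lc x ≤ lexKey lc (T j)) →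
      (∀ j, a j ∈ (g j).support) → ∑ j, a j = e →
      (∀ x : Fin 2 →₀ ℕ, x ≠ e → lc (emb e) ≤ lc (emb x) → coeff x (∏ j, g j) + coeff x (∏ j, f j) = 0) →
      coeff e (∏ j, g j) + coeff e (∏ j, f j) ≠ 0 → ∑ j, T' j = ∑ j, T j → lexKey lc e < lexKey lc (∑ j, T' j) →
      (∃ q : Fin K → Option (Fin m × (Fin 2 →₀ ℕ)), (∀ i p, q i = some p → p.2 ∈ (g p.1).support) ∧
          emb e = emb (∑ j, T' j) - ∑ i, Option.elim (q i) (0 : Fin 2 → ℝ) (fun p => emb (T' p.1) - emb p.2)) ∨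
        ∃ q : Fin K → Option (Fin m × (Fin 2 →₀ ℕ)), (∀ i p, q i = some p → p.2 ∈ (f p.1).support) ∧
          emb e = emb (∑ j, T j) - ∑ i, Option.elim (q i) (0 : Fin 2 → ℝ) (fun p => emb (T p.1) - emb p.2)) :
    {p : Fin 2 → ℝ | p ∈ Set.extremePoints ℝ (convexHull ℝ
          (emb '' ((∏ j, f j + ∏ j, g j).support : Set (Fin 2 →₀ ℕ)))) ∧
        ∃ l : (Fin 2 → ℝ) →ₗ[ℝ] ℝ,
          (∀ q ∈ emb '' ((∏ j, f j + ∏ j, g j).support : Set (Fin 2 →₀ ℕ)), q ≠ p → l q < l p) ∧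
          ∃ q ∈ emb '' ((∏ j, f j).support : Set (Fin 2 →₀ ℕ)) ∪ emb '' ((∏ j, g j).support : Set (Fin 2 →₀ ℕ)),
            l p < l q}.ncard ≤ 2 * ((4 * (m * t) ^ 2 + 7) * (m * t + 1) ^ K) := by
  by_cases h0 : (∀ j, f j ≠ 0) ∧ (∀ j, g j ≠ 0)
  swap
  · have hsub : (∏ j, f j).support ∪ (∏ j, g j).support ⊆ (∏ j, f j + ∏ j, g j).support := by
      rw [not_and_or] at h0
      rcases h0 with h | h
      · push Not at h
        obtain ⟨j, hj⟩ := h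
        rw [Finset.prod_eq_zero (Finset.mem_univ j) hj, support_zero, Finset.empty_union, zero_add]
      · push Not at h
        obtain ⟨j, hj⟩ := h
        rw [Finset.prod_eq_zero (Finset.mem_univ j) hj, support_zero, Finset.union_empty, add_zero]
    rw [cross_empty_of_union_subset _ _ _ hsub, Set.ncard_empty]
    exact Nat.zero_le _
  obtain ⟨hf0, hg0⟩ := h0
  have hnef : ∀ j, ((f j).support).Nonempty := fun j => by
    rw [Finset.nonempty_iff_ne_empty, Ne, MvPolynomial.support_eq_empty]; exact hf0 j
  have hneg : ∀ j, ((g j).support).Nonempty := fun j => by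
    rw [Finset.nonempty_iff_ne_empty, Ne, MvPolynomial.support_eq_empty]; exact hg0 j
  have hSf : ∀ j, ((f j).support).card ≤ t := fun j => (Finset.card_le_card (hf j)).trans (hA j)
  have hSg : ∀ j, ((g j).support).card ≤ t := fun j => (Finset.card_le_card (hg j)).trans (hB j)
  have hinjf : ∀ a b : Fin m → (Fin 2 →₀ ℕ), (∀ j, a j ∈ (f j).support) → (∀ j, b j ∈ (f j).support) →
      ∑ j, a j = ∑ j, b j → a = b := fun a b ha hb => hinjA a b (fun j => hf j (ha j)) (fun j => hf j (hb j))
  have hinjg : ∀ a b : Fin m → (Fin 2 →₀ ℕ), (∀ j, a j ∈ (g j).support) → (∀ j, b j ∈ (g j).support) →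
      ∑ j, a j = ∑ j, b j → a = b := fun a b ha hb => hinjB a b (fun j => hg j (ha j)) (fun j => hg j (hb j))
  -- the two `K`-gap covering families
  set Uf : Finset (Fin 2 → ℝ) := ((Fintype.piFinset fun j => (f j).support).filter fun b =>
        ∃ l : (Fin 2 → ℝ) →L[ℝ] ℝ, ∀ j, ∀ x ∈ (f j).support, lexKey l x ≤ lexKey l (b j)).biUnion fun b =>
      (Fintype.piFinset fun _ : Fin K =>
          Finset.insertNone (Finset.univ.biUnion fun j => ((f j).support).image (Prod.mk j))).image fun q =>
        emb (∑ j, b j) - ∑ i, Option.elim (q i) (0 : Fin 2 → ℝ) (fun p => emb (b p.1) - emb p.2) with hUf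
  set Ug : Finset (Fin 2 → ℝ) := ((Fintype.piFinset fun j => (g j).support).filter fun b =>
        ∃ l : (Fin 2 → ℝ) →L[ℝ] ℝ, ∀ j, ∀ x ∈ (g j).support, lexKey l x ≤ lexKey l (b j)).biUnion fun b =>
      (Fintype.piFinset fun _ : Fin K =>
          Finset.insertNone (Finset.univ.biUnion fun j => ((g j).support).image (Prod.mk j))).image fun q =>
        emb (∑ j, b j) - ∑ i, Option.elim (q i) (0 : Fin 2 → ℝ) (fun p => emb (b p.1) - emb p.2) with hUg
  have hcover : {p : Fin 2 → ℝ | p ∈ Set.extremePoints ℝ (convexHull ℝ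
          (emb '' ((∏ j, f j + ∏ j, g j).support : Set (Fin 2 →₀ ℕ)))) ∧
        ∃ l : (Fin 2 → ℝ) →ₗ[ℝ] ℝ,
          (∀ q ∈ emb '' ((∏ j, f j + ∏ j, g j).support : Set (Fin 2 →₀ ℕ)), q ≠ p → l q < l p) ∧
          ∃ q ∈ emb '' ((∏ j, f j).support : Set (Fin 2 →₀ ℕ)) ∪ emb '' ((∏ j, g j).support : Set (Fin 2 →₀ ℕ)),
            l p < l q} ⊆ ↑(Uf ∪ Ug) := by
    rintro p ⟨hp, l, hl, q, hq, hlt⟩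
    obtain ⟨e, he, rfl⟩ := extremePoints_convexHull_subset hp
    have he' : e ∈ (∏ j, f j + ∏ j, g j).support := he
    set lc : (Fin 2 → ℝ) →L[ℝ] ℝ := LinearMap.toContinuousLinearMap l with hlc
    have hlcl : ∀ v, lc v = l v := fun v => rfl
    set T : Fin m → (Fin 2 →₀ ℕ) := fun j => lexTop lc ((f j).support) (hnef j) with hTdef
    set T' : Fin m → (Fin 2 →₀ ℕ) := fun j => lexTop lc ((g j).support) (hneg j) with hT'def
    have hT : ∀ j, T j ∈ (f j).support := fun j => lexTop_mem _ _ _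
    have hT' : ∀ j, T' j ∈ (g j).support := fun j => lexTop_mem _ _ _
    have hTmax : ∀ j, ∀ x ∈ (f j).support, lexKey lc x ≤ lexKey lc (T j) := fun j x hx => lexKey_le_lexTop _ _ _ hx
    have hTmax' : ∀ j, ∀ x ∈ (g j).support, lexKey lc x ≤ lexKey lc (T' j) := fun j x hx => lexKey_le_lexTop _ _ _ hx
    have hzero : ∀ x : Fin 2 →₀ ℕ, x ≠ e → lc (emb e) ≤ lc (emb x) →
        coeff x (∏ j, f j) + coeff x (∏ j, g j) = 0 := by
      intro x hxe hle
      by_contra hne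
      have hx : x ∈ (∏ j, f j + ∏ j, g j).support := by rw [mem_support_iff, coeff_add]; exact hne
      have h := hl (emb x) ⟨x, hx, rfl⟩ (fun h => hxe (emb_injective h))
      rw [hlcl, hlcl] at hle
      exact absurd h (not_lt.2 hle)
    have hzero' : ∀ x : Fin 2 →₀ ℕ, x ≠ e → lc (emb e) ≤ lc (emb x) →
        coeff x (∏ j, g j) + coeff x (∏ j, f j) = 0 := fun x hx hle => by rw [add_comm]; exact hzero x hx hle
    have heF : coeff e (∏ j, f j) + coeff e (∏ j, g j) ≠ 0 := by
      rw [← coeff_add]; exact mem_support_iff.1 he'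
    have heF' : coeff e (∏ j, g j) + coeff e (∏ j, f j) ≠ 0 := by rwa [add_comm]
    have htops : ∑ j, T j = ∑ j, T' j ∧ lexKey lc e < lexKey lc (∑ j, T j) := by
      rcases hq with ⟨x, hx, rfl⟩ | ⟨x, hx, rfl⟩
      · exact top_eq lc f g T T' hT hTmax hT' hTmax' hinjf hinjg e hzero ⟨x, hx, by rwa [hlcl, hlcl]⟩
      · have h := top_eq lc g f T' T hT' hTmax' hT hTmax hinjg hinjf e hzero' ⟨x, hx, by rwa [hlcl, hlcl]⟩
        refine ⟨h.1.symm, ?_⟩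
        rw [← h.1]; exact h.2
    obtain ⟨htop, hTe⟩ := htops
    have hTe' : lexKey lc e < lexKey lc (∑ j, T' j) := htop ▸ hTe
    rw [Finset.coe_union]
    rcases Finset.mem_union.1 (support_add he') with hef | heg
    · obtain ⟨a, ha, hae⟩ := exists_word f hinjf hef
      rcases hcov lc e T T' a hT hTmax hT' hTmax' ha hae hzero heF htop hTe with ⟨q', hq', hE⟩ | ⟨q', hq', hE⟩
      · rw [hE]; exact Or.inl (mem_coverK lc f T hT hTmax q' hq')
      · rw [hE]; exact Or.inr (mem_coverK lc g T' hT' hTmax' q' hq')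
    · obtain ⟨a, ha, hae⟩ := exists_word g hinjg heg
      rcases hcov' lc e T' T a hT' hTmax' hT hTmax ha hae hzero' heF' htop.symm hTe' with ⟨q', hq', hE⟩ | ⟨q', hq', hE⟩
      · rw [hE]; exact Or.inr (mem_coverK lc g T' hT' hTmax' q' hq')
      · rw [hE]; exact Or.inl (mem_coverK lc f T hT hTmax q' hq')
  calc _ ≤ (↑(Uf ∪ Ug) : Set (Fin 2 → ℝ)).ncard := Set.ncard_le_ncard hcover (Finset.finite_toSet _)
    _ = (Uf ∪ Ug).card := Set.ncard_coe_finset _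
    _ ≤ Uf.card + Ug.card := Finset.card_union_le _ _
    _ ≤ (4 * (m * t) ^ 2 + 7) * (m * t + 1) ^ K + (4 * (m * t) ^ 2 + 7) * (m * t + 1) ^ K :=
        Nat.add_le_add (card_coverK_le K t f hSf) (card_coverK_le K t g hSg)
    _ = 2 * ((4 * (m * t) ^ 2 + 7) * (m * t + 1) ^ K) := by ring

/-- **The count from the four-letter law T4** (`memo-IX-windows.md` §3): if at every cross-cancelling vertex whose word demotes `≥ 2`
letters the top gap is a sum of at most four letter gaps of the OTHER frame (`hT4` for words of `f`, `hT4'` for words of `g`), then the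
cross-cancelling vertices number `≤ 2 (4(mt)²+7)(mt+1)⁴`.  T4 is numerically exact (≈ 2·10⁵ factorization pairs, member depth 2, 3, 4, 5)
and, unlike (IX), needs no depth-4 threshold; it is OPEN. [ours] -/
theorem crossCancel_of_fourLetters (m t : ℕ) (A B : Fin m → Finset (Fin 2 →₀ ℕ))
    (f g : Fin m → MvPolynomial (Fin 2) ℂ)
    (hA : ∀ j, (A j).card ≤ t) (hB : ∀ j, (B j).card ≤ t)
    (hf : ∀ j, (f j).support ⊆ A j) (hg : ∀ j, (g j).support ⊆ B j)
    (hinjA : ∀ a b : Fin m → (Fin 2 →₀ ℕ), (∀ j, a j ∈ A j) → (∀ j, b j ∈ A j) → ∑ j, a j = ∑ j, b j → a = b)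
    (hinjB : ∀ a b : Fin m → (Fin 2 →₀ ℕ), (∀ j, a j ∈ B j) → (∀ j, b j ∈ B j) → ∑ j, a j = ∑ j, b j → a = b)
    (hT4 : ∀ (lc : (Fin 2 → ℝ) →L[ℝ] ℝ) (e : Fin 2 →₀ ℕ) (T T' a : Fin m → (Fin 2 →₀ ℕ)),
      (∀ j, T j ∈ (f j).support) → (∀ j, ∀ x ∈ (f j).support, lexKey lc x ≤ lexKey lc (T j)) →
      (∀ j, T' j ∈ (g j).support) → (∀ j, ∀ x ∈ (g j).support, lexKey lc x ≤ lexKey lc (T' j)) →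
      (∀ j, a j ∈ (f j).support) → ∑ j, a j = e →
      (∀ x : Fin 2 →₀ ℕ, x ≠ e → lc (emb e) ≤ lc (emb x) → coeff x (∏ j, f j) + coeff x (∏ j, g j) = 0) →
      coeff e (∏ j, f j) + coeff e (∏ j, g j) ≠ 0 → ∑ j, T j = ∑ j, T' j → lexKey lc e < lexKey lc (∑ j, T j) →
      (Finset.univ.filter fun i => a i ≠ T i).card ≤ 1 ∨
        ∃ (p : Fin 4 → Fin m) (y : Fin 4 → (Fin 2 →₀ ℕ)), (∀ i, y i ∈ (g (p i)).support) ∧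
          emb e = emb (∑ j, T' j) - ∑ i, (emb (T' (p i)) - emb (y i)))
    (hT4' : ∀ (lc : (Fin 2 → ℝ) →L[ℝ] ℝ) (e : Fin 2 →₀ ℕ) (T' T a : Fin m → (Fin 2 →₀ ℕ)),
      (∀ j, T' j ∈ (g j).support) → (∀ j, ∀ x ∈ (g j).support, lexKey lc x ≤ lexKey lc (T' j)) →
      (∀ j, T j ∈ (f j).support) → (∀ j, ∀ x ∈ (f j).support, lexKey lc x ≤ lexKey lc (T j)) →
      (∀ j, a j ∈ (g j).support) → ∑ j, a j = e →
      (∀ x : Fin 2 →₀ ℕ, x ≠ e → lc (emb e) ≤ lc (emb x) → coeff x (∏ j, g j) + coeff x (∏ j, f j) = 0) →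
      coeff e (∏ j, g j) + coeff e (∏ j, f j) ≠ 0 → ∑ j, T' j = ∑ j, T j → lexKey lc e < lexKey lc (∑ j, T' j) →
      (Finset.univ.filter fun i => a i ≠ T' i).card ≤ 1 ∨
        ∃ (p : Fin 4 → Fin m) (y : Fin 4 → (Fin 2 →₀ ℕ)), (∀ i, y i ∈ (f (p i)).support) ∧
          emb e = emb (∑ j, T j) - ∑ i, (emb (T (p i)) - emb (y i))) :
    {p : Fin 2 → ℝ | p ∈ Set.extremePoints ℝ (convexHull ℝ
          (emb '' ((∏ j, f j + ∏ j, g j).support : Set (Fin 2 →₀ ℕ)))) ∧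
        ∃ l : (Fin 2 → ℝ) →ₗ[ℝ] ℝ,
          (∀ q ∈ emb '' ((∏ j, f j + ∏ j, g j).support : Set (Fin 2 →₀ ℕ)), q ≠ p → l q < l p) ∧
          ∃ q ∈ emb '' ((∏ j, f j).support : Set (Fin 2 →₀ ℕ)) ∪ emb '' ((∏ j, g j).support : Set (Fin 2 →₀ ℕ)),
            l p < l q}.ncard ≤ 2 * ((4 * (m * t) ^ 2 + 7) * (m * t + 1) ^ 4) := by
  -- a list of four genuine gaps is a list of four optional gaps
  have hlist : ∀ (h : Fin m → MvPolynomial (Fin 2) ℂ) (S : Fin m → (Fin 2 →₀ ℕ)) (p : Fin 4 → Fin m)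
      (y : Fin 4 → (Fin 2 →₀ ℕ)), (∀ i, y i ∈ (h (p i)).support) →
      ∃ q : Fin 4 → Option (Fin m × (Fin 2 →₀ ℕ)), (∀ i r, q i = some r → r.2 ∈ (h r.1).support) ∧
        ∑ i, (emb (S (p i)) - emb (y i)) = ∑ i, Option.elim (q i) (0 : Fin 2 → ℝ) (fun r => emb (S r.1) - emb r.2) := by
    intro h S p y hy
    refine ⟨fun i => some (p i, y i), fun i r hr => ?_, Finset.sum_congr rfl fun i _ => rfl⟩
    cases hr; exact hy i
  refine crossCancel_of_gapCover 4 m t A B f g hA hB hf hg hinjA hinjB ?_ ?_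
  · intro lc e T T' a hT hTmax hT' hTmax' ha hae hzero he htop hTe
    rcases hT4 lc e T T' a hT hTmax hT' hTmax' ha hae hzero he htop hTe with hc | ⟨p, y, hy, hE⟩
    · obtain ⟨q, hq, hq'⟩ := exists_gapForm_of_card_le 4 f T a ha (hc.trans (by norm_num))
      exact Or.inl ⟨q, hq, by rw [← hae]; exact hq'⟩
    · obtain ⟨q, hq, hs⟩ := hlist g T' p y hy
      exact Or.inr ⟨q, hq, by rw [hE, hs]⟩
  · intro lc e T' T a hT' hTmax' hT hTmax ha hae hzero he htop hTe
    rcases hT4' lc e T' T a hT' hTmax' hT hTmax ha hae hzero he htop hTe with hc | ⟨p, y, hy, hE⟩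
    · obtain ⟨q, hq, hq'⟩ := exists_gapForm_of_card_le 4 g T' a ha (hc.trans (by norm_num))
      exact Or.inl ⟨q, hq, by rw [← hae]; exact hq'⟩
    · obtain ⟨q, hq, hs⟩ := hlist f T p y hy
      exact Or.inr ⟨q, hq, by rw [hE, hs]⟩

end CoverK

end

end Summit.ValiantsHypothesis.ValiantsHypothesis.Theorems.NewtonFramesTwoProducts.FrameRungTwoTrinomial
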